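import Literature.MathematicalPhysics.QuantumFieldTheory.Balaban1983to89.B2Eq265TailsPow
import Literature.MathematicalPhysics.QuantumFieldTheory.Balaban1983to89.B2Eq265HiggsTower

/-!
# `Balaban1983to89.B2Eq265HiggsTowerPow` — [Balaban1982Higgs2] Lemma 2.4 (2.65) p.572, value clause «under the restrictions (2.55)»,
# ON THE (Higgs)₂,₃ CARRIER OF RECORD FOR PRINT'S OWN REGIONS (F14) WITH THE TWO (2.67) TAILS IN PRINT'S `O((Lᵏε)^κ)` FORM (F15):
# the tower instance of own F15 `B2Eq265TailsPow.eq265_higgs_region_pow` — regions `Λ₂^{(k−1)′} ⊇ Λ₆^{(k−1)′}`, `Λ₋₁^{(k−1)′} ⊇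
# (near Λ₀^{(k−1)} r)′` = the typer's (2.7)–(2.8)/(2.43) tower of step `j = k − 1` primed, cube size `K₀ = M`, exactly as own F14
# `B2Eq265HiggsTower.eq265_higgs_tower` instantiated F13 (`eq265_higgs_tower_pow`); and the same with the tower's radius function
# read as print's (2.7) `r(Lⁱε) = R(1 + log (Lⁱε)⁻¹)^r` at every step (`eq265_higgs_tower_pow_r`)

statement-level skeleton of published theorems with citation tags; proofs where landed; nothing here is a claim
about the Yang–Mills mass gap

PDF held: `paper:balaban1982-cmp86-higgs23-ii` (journal page = PDF page + 554), p. 572 [PDF 18] (Lemma 2.4, (2.67)), p. 570 [PDF 16]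
((2.55)/(2.56)), p. 558 [PDF 4] ((2.7)–(2.8): «r(ε) = R(1 + log ε⁻¹)^r … r > 1, R > R₀»; «Λ_{i+1}ᶜ is the sum of all large blocks of T₁
with distances from the set Λ_iᶜ less or equal r(ε)»), p. 566 [PDF 12] ((2.43)), p. 570 [PDF 16] («Λ₋₁^{(k)} is the sum of large blocks of
the lattice T₁^{(k)} contained in Λ^{(k−1)′} distant from the set B(P_v^{(k)}) ∪ … more than r(Lᵏε)» — the radius at step `k` is `r(Lᵏε)`).

CITATION HEADER (lean-in-tree rule).  T. Bałaban, *(Higgs)₂,₃ quantum fields in a finite volume. II. An upper bound*,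
Commun. Math. Phys. **86** (1982) 555–594, doi:10.1007/bf01214890 [Balaban1982Higgs2].  Cell `lit-balaban` (HOME
`run/shared/lean/pub/lit-balaban/`), Phase-2 proof seat **p23** gen 23 (unit `lit-balaban-p23-g23`; free-target protocol G.5-34(d), TAKING #1
line HOME/STATUS.md 2026-08-23); SKELETON row **B2.Lem2.4** (fold owner r02, second reader r14; head `proved p250408 · …` UNCHANGED —
cells-only member, brick F16).  USED BY NAME, never restated: own F15 `B2Eq265TailsPow.eq265_higgs_region_pow`; the typer's tower
`B2Eq243RegionsTower.towerRegion`, `B2Eq324NestedRegions.prime`, `B2Eq28RegionsConcrete.near`; own gen-13 `B2Eq28RegionsCollars.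
nbhd_towerRegion` ((2.8) collars), own gen-17 `B2Eq28RegionsBigBlockUnion.isBigBlockUnion_towerRegion_prime`, own gen-20
`B2Eq267HiggsRegion.prime_towerRegion_six_subset_two`; p15's `B2Ineq329BlockPoincare.blockIter_toFinest`; r14's `B3Ineq210RegularTorus.mesh_mono`; b2b's `B2.rFn`,
`B2.Params.Printed`.

THE ARGUMENT.  F15's `eq265_higgs_region_pow` holds for arbitrary coarse regions `Λ₋₁, Λ₂ ⊇ Λ₆` with `Bᵏ(Λ₂)` a big-block union of cube size
`K₀ ∣ M` and the cube condition «`y ∈ Λ₂`, `|y − y′| ≤ R_n` ⇒ `y′ ∈ Λ₋₁`».  For print's regions of step `j` primed to `T^{(k)}`, `k = j + 1`,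
exactly as in F14: `Λ₆^{(j)′} ⊆ Λ₂^{(j)′}` (tower monotonicity), `Bᵏ(Λ₂^{(j)′})` is a big-block union of cube size `M`, and the (2.8) collars
plus the «additional thickness r(Lʲε)» give the cube condition into `(near Λ₀^{(j)} r(Lʲε))′` under the room condition `L(R_n + 1) − 1 ≤ 3n`,
`n < r(Lʲε)`.  With `rad i := r(Lⁱε)` (print's (2.7) at every step) `0 < rad j` holds for the printed ranges `R > 0` and `Lʲε ≤ 1`.

WHAT THIS FILE PROVES (kernel-checked, zero `sorry`; theorems only — NO definition, NO `Prop`-valued fact; axioms standard).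
 **`eq265_higgs_tower_pow`** — F15's `eq265_higgs_region_pow` word for word except (located edits, the same list as F14's over F13):
 `∃ K₀min ∀ K₀ ≥ K₀min … K₀ ∣ P.M` ↦ `∃ Mmin ∀ M ≥ Mmin … P.M = M`; level `k` ↦ `j + 1` (`1 ≤ k` dropped, `k ≤ K` ↦ `j + 1 ≤ K`); the
 binders `(Λ₂ Λ₆ …)`, `Λ₆ ⊆ Λ₂ →`, `IsBigBlockUnion k K₀ (underRegion k Λ₂) →` and `(Λm1 …)` ↦ the tower data `(bad) (rad), 0 < rad j →` with
 `Λ₂ := prime (towerRegion bad rad j 2)`, `Λ₆ := prime (towerRegion bad rad j 6)`, `Λm1 := prime (near (towerRegion bad rad j 0) (rad j))`;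
 the cube condition ↦ `∀ (n : ℕ), n < rad j → L(R_n + 1) − 1 ≤ 3n →`.  The bound is F15's with `K₀ ↦ M`, `k ↦ j + 1`.
 **`eq265_higgs_tower_pow_r`** — the same with `rad := fun i => B2.rFn Q.R Q.r (P.mesh i)` substituted (binders `(rad)`, `0 < rad j →`
 removed; the room condition reads `n < r(Lʲε)`).

HONEST SCOPE / DIFFERENCES FROM PRINT (recorded, not hidden; one sentence each).  (a) = F14 (a)–(c): `□₂ ⊆ Λ₂^{(j)′}`, `□₁ ⊆ Λ₆^{(j)′}`,
`Bᵏ(□₂)` a cell box of cube size `M` STAY HYPOTHESES (print's `□₁, □₂` are truncated to `Λ₇′`, GAPS G-B2-p23-01 reading; full boxes here);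
the ROOM CONDITION is the cell's reading (c) of GAPS G-B2-12; `Λ₋₁` is the POINT part of print's `Λ^{(*,′)}_{−1}`.  (b) = F15 (a)–(b):
ONLY THE TWO (2.67) TAILS are `O((Lᵏε)^κ)` — the (2.68)/(2.76)/(2.75)/transport terms stay explicit (their printed sizes need the
(2.5)–(2.7) scaling dictionary; row B2.Lem2.4's «final SIZE» residue); `θ₁, θ₂ > 0`, `T, m′` free (print: `m ⇐ 4r`, `R₁ ⇐ 2r` about `y`).
(c) In `eq265_higgs_tower_pow` which sites are large-field (`bad`) and the radius function `rad` are data; `_r` fixes `rad` to print's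
(2.7) `r(Lⁱε)` for the SAME printed parameters `Q` as the `□`-radii readings, `bad` stays data.  (d) Everything else as in F15's/F14's
HONEST SCOPE (value clause only; torus sub-family `Shape P`, odd `L > 1`, `P.M = M`; zero external field in (2.54); general (2.55)
letters; base point the corner; nothing minted — `Mmin` is F15's `K₀min`, `e₁, t, C₁ … D₄, C′` F15's, `δ, C_V, C_F` Lemma 2.3's).
NOT summit progress.
-/

open scoped BigOperators

noncomputable section

namespace Literature.MathematicalPhysics.QuantumFieldTheory.Balaban1983to89.B2Eq265HiggsTowerPow

open HiggsLattice (ChargeData)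
open HiggsAveraging (blockIter toFinest)
open HiggsCovariance (avgQkAdj)
open B2Eq255Concrete (bgScalar256 underRegion mem_underRegion Restr255)
open B2Eq265TailsPow (eq265_higgs_region_pow)
open B2Eq324NestedRegions (prime)
open B2Eq243RegionsTower (towerRegion)
open B2Eq28RegionsConcrete (near)
open B2Eq28RegionsCollars (nbhd_towerRegion)
open B2Eq28RegionsBigBlockUnion (isBigBlockUnion_towerRegion_prime)
open B2Eq267HiggsRegion (prime_towerRegion_six_subset_two)
open B2Ineq329BlockPoincare (blockIter_toFinest)
open B2Lemma23HiggsLattice (cutMin)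
open B1Eq211ZeroFieldTorus (Shape)
open B3MultiscaleFields (toSite ofSite)
open B1Ineq225RegularBox (cellBox)
open B1TorusRegionHSizes (IsBigBlockUnion)
open B1TorusCubeCover (half)
open B1TorusCubeLocality26 (rS)

variable {P : HiggsLattice.Params}

/-! ## (2.65) for print's own regions, the (2.67) tails as `O((Lᵏε)^κ)` -/

section TowerPow

/-- **LEMMA 2.4 (2.65), VALUE CLAUSE, «UNDER THE RESTRICTIONS (2.55)», FOR PRINT'S OWN REGIONS `Λ₂^{(k−1)′} ⊇ Λ₆^{(k−1)′}`,
`Λ₋₁^{(k−1)′} ⊇ (near Λ₀^{(k−1)} r)′`, cube size `K₀ = M`, THE TWO (2.67) TAILS AS PRINT'S `O((Lᵏε)^κ)`.**  TYPED vs PRINTED: own F15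
`B2Eq265TailsPow.eq265_higgs_region_pow` word for word except the located edits (F14's list): `∃ K₀min ∀ K₀ ≥ K₀min … K₀ ∣ P.M` ↦
`∃ Mmin ∀ M ≥ Mmin … P.M = M` («M sufficiently large»); level `k` ↦ `j + 1`; the binders `(Λ₂ Λ₆ …)`, `Λ₆ ⊆ Λ₂ →`,
`IsBigBlockUnion k K₀ (underRegion k Λ₂) →` and `(Λm1 …)` ↦ the tower data `(bad) (rad), 0 < rad j →` with
`Λ₂ := prime (towerRegion bad rad j 2)`, `Λ₆ := prime (towerRegion bad rad j 6)`, `Λm1 := prime (near (towerRegion bad rad j 0) (rad j))`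
substituted; the cube condition `(∀ y ∈ Λ₂, ∀ y′, |y − y′| ≤ R_n → y′ ∈ Λm1) →` ↦ `∀ (n : ℕ), n < rad j → L(R_n + 1) − 1 ≤ 3n →`.  The
bound is F15's with `K₀ ↦ M`, `k ↦ j + 1`; `Mmin` IS F15's `K₀min` and `e₁, t, C₁ … D₄, C′, δ, C_V, C_F` are F15's — nothing is minted here.
[cite: Balaban1982Higgs2, Lemma 2.4 (2.65) p.572] [cite: Balaban1982Higgs2, (2.56) p.570, (2.55) p.570, (2.7)–(2.8) p.558, (2.43) p.566]
[cite: Balaban1982Higgs2, Lemma 2.4 proof (2.67) p.572 «Using Proposition 2.2 and the restrictions (2.55) we get φ^{(k)}(x) = (a_kG_k(□, A^{(k)})Q_k^*(A^{(k)})□₁φ)(x) + O((Lᵏε)^κ), x ∈ Bᵏ(y)»]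
[cite: Balaban1982Higgs1, Prop. 2.1 p.610 «let Ω^{(k)} ⊂ T^{(k)}_1 be a sum of big blocks with M sufficiently large»] -/
theorem eq265_higgs_tower_pow (d L : ℕ) (hd : 1 ≤ d) (hL : Odd L ∧ 1 < L) {a : ℝ} (ha : 0 < a) {msq : ℝ} (hmsq : 0 < msq)
    {aV : ℝ} (haV : 0 < aV) {mu0sq : ℝ} (hmu0 : 0 < mu0sq)
    (N : ℕ) (C : ChargeData N) (ε₀ : ℝ) (creg β : ℝ) (hcreg : 0 ≤ creg) (hβ : 0 < β)
    (Q : B2.Params) (hQ : Q.Printed) {T : ℝ} (hT : 0 ≤ T) (mexp : ℝ) {θ₁ θ₂ : ℝ} (hθ₁ : 0 < θ₁) (hθ₂ : 0 < θ₂) (κ : ℝ) :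
    ∃ δ CV CF : ℝ, 0 < δ ∧ 0 < CV ∧ 0 < CF ∧
    ∃ Mmin : ℕ, ∀ M : ℕ, Mmin ≤ M → ∃ e₁ t : ℝ, 0 < e₁ ∧ 0 < t ∧
      ∃ C₁ C₂ C₃ D₁ D₂ D₃ D₄ : ℝ, 0 ≤ C₁ ∧ 0 ≤ C₂ ∧ 0 ≤ C₃ ∧ 0 ≤ D₁ ∧ 0 ≤ D₂ ∧ 0 ≤ D₃ ∧ 0 ≤ D₄ ∧ ∃ C' : ℝ, 0 ≤ C' ∧
      ∀ (P : HiggsLattice.Params) (_ : Shape P), P.d = d → P.L = L → P.M = M →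
      ∀ {j : ℕ}, j + 1 ≤ P.K → (∀ μ, 3 * half P (j + 1) M ≤ P.sitesPerDir 0 μ) → P.mesh (j + 1) ≤ ε₀ → P.mesh (j + 1) ≤ 1 →
      -- PRINT'S OWN REGIONS: the (2.7)–(2.8)/(2.43) tower of step `j`, primed to `T^{(k)}`, `k = j + 1`; `Λ₂′ ⊇ □₂`, `Λ₆′ ⊇ □₁`
      ∀ (bad : (l : ℕ) → Set (HiggsLattice.Site P l)) (rad : ℕ → ℝ), 0 < rad j →
      ∀ (sq₂ sq₁ : Finset (HiggsLattice.Site P (j + 1))) (S : Fin P.d → Finset ℕ) (q : HiggsLattice.Site P (j + 1)) (Sbox : ℕ),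
        sq₂ ⊆ prime (towerRegion bad rad j 2) → sq₁ ⊆ prime (towerRegion bad rad j 6) →
        underRegion (j + 1) sq₂ = cellBox (j + 1) M S →
        (∀ μ : Fin P.d, P.L ^ (j + 1) * Sbox < P.sitesPerDir 0 μ) →
      -- `□₂` IS the box `q + [0,S)ᵈ` of coarse sites, `□ = B^k(□₂)` smaller than half the torus
        (∀ y : HiggsLattice.Site P (j + 1), y ∈ sq₂ ↔ ∀ ν : Fin P.d, (y ν - q ν).val < Sbox) →
        (∀ μ : Fin P.d, 2 * (P.L ^ (j + 1) * Sbox) ≤ P.sitesPerDir 0 μ) →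
      -- `□₁` is the box of coarse sites of radius `R₁` (corner `q₁`); `m ≥ R₁` a coarse margin with `Lᵏm ≥` the depth radius
      ∀ (q₁ : HiggsLattice.Site P (j + 1)) (R₁ m : ℕ), R₁ ≤ m → 2 * rS P (j + 1) M + 2 * half P (j + 1) M * (P.d + 1) + 1 ≤ P.L ^ (j + 1) * m →
        (∀ y : HiggsLattice.Site P (j + 1), y ∈ sq₁ ↔ ∀ ν : Fin P.d, (y ν - q₁ ν).val < 2 * R₁ + 1) →
      -- the cutoff `ζ^{(k)}` of (2.44)
      ∀ (ζ : HiggsLattice.Site P 0 → HiggsLattice.Site P (j + 1) → ℝ) (ρ ρ₁ : ℝ), 0 ≤ ρ₁ →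
        (∀ x y', |ζ x y'| ≤ 1) →
        (∀ x y', ζ x y' ≠ 0 → (HiggsLattice.Site.tdist (blockIter (j + 1) x) y' : ℝ) ≤ ρ) →
        (∀ x y', (HiggsLattice.Site.tdist (blockIter (j + 1) x) y' : ℝ) ≤ ρ₁ → ζ x y' = 1) →
        (∀ (x : HiggsLattice.Site P 0) (ν : Fin P.d) (y' : HiggsLattice.Site P (j + 1)), |ζ (x.shift ν) y' - ζ x y'| ≤ ((P.L : ℝ) ^ (j + 1))⁻¹) →
      -- the cube of radius `R_n ≥ ρ + 1` about `y ∈ Λ₂′` lies in `Λ₋₁′ := (near Λ₀^{(j)} r(Lʲε))′` once `L(R_n + 1) − 1 ≤ 3n`, `n < r(Lʲε)` ((2.8) collars)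
      ∀ (Rn : ℕ), ρ + 1 ≤ (Rn : ℝ) → (∀ μ : Fin P.d, 2 * (2 * Rn + 1) ≤ P.sitesPerDir (j + 1) μ) →
      ∀ (n : ℕ), (n : ℝ) < rad j → (P.L : ℝ) * ((Rn : ℝ) + 1) - 1 ≤ 3 * (n : ℝ) →
      -- a charge datum on `ℝ^d`, the step's vector field `A′`, and the letters of (2.55)
      ∀ (C₀ : ChargeData P.d) (A' : HiggsLattice.VecField P (j + 1)) {c₁ pℓ tA tPhi : ℝ}, 0 ≤ c₁ → 0 ≤ pℓ → 0 ≤ tPhi →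
      -- the printed readings of the radii and a polynomial size of the `φ`-threshold: `m ≥ θ₁r(Lᵏε)`, `R₁ + 1 ≥ θ₂r(Lᵏε)`, `c₁·tPhi·pℓ ≤ T(Lᵏε)^{−m′}`
        θ₁ * B2.rFn Q.R Q.r (P.mesh (j + 1)) ≤ (m : ℝ) → θ₂ * B2.rFn Q.R Q.r (P.mesh (j + 1)) ≤ (R₁ : ℝ) + 1 →
        c₁ * tPhi * pℓ ≤ T * P.mesh (j + 1) ^ (-mexp) →
      -- `δA` is at least the (2.60) bound read off (2.55)₁,₂, and small in the two printed scalings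
      ∀ {δA : ℝ}, ((P.L : ℝ) ^ (j + 1))⁻¹ * (CV * P.d * (P.mesh (j + 1) * (c₁ * pℓ)) + CF * Real.exp (-(δ * ρ₁)) * (c₁ * tA * pℓ)) ≤ δA →
          (P.L : ℝ) ^ (j + 1) * δA * |C.e| ≤ t →
        ∀ {ec : ℝ}, 0 < ec → ec ≤ e₁ → (P.L : ℝ) ^ (j + 1) * P.mesh (j + 1) * |C.e| * δA ≤ creg * ec ^ β →
      -- `x ∈ Bᵏ(ȳ)` with `ȳ` the centre of `□₁` and at least `m` inside `□₂` in every direction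
      ∀ (x : HiggsLattice.Site P 0),
        (∀ ν : Fin P.d, m ≤ ((blockIter (j + 1) x) ν - q ν).val ∧ ((blockIter (j + 1) x) ν - q ν).val + m < Sbox) →
        (∀ ν : Fin P.d, ((blockIter (j + 1) x) ν - q₁ ν).val = R₁) →
      -- THE RESTRICTIONS (2.55) on `Λ₋₁` for the fields `A′, φ` of the step and the background `A^{(k)} = a_kζ^{(k)}G_kQ_k^*A′` — all four conjuncts used
      ∀ (φ : HiggsLattice.ScalarField P (j + 1) N),
        Restr255 C c₁ pℓ tA tPhi (j + 1) (prime (near (towerRegion bad rad j 0) (rad j))) A' φ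
          (ofSite (cutMin C₀ mu0sq aV (j + 1) ζ (toSite A'))) →
        ‖bgScalar256 C msq a (j + 1) (prime (towerRegion bad rad j 2)) (prime (towerRegion bad rad j 6))
              (ofSite (cutMin C₀ mu0sq aV (j + 1) ζ (toSite A'))) φ x
            - avgQkAdj C (ofSite (cutMin C₀ mu0sq aV (j + 1) ζ (toSite A'))) (j + 1) φ x‖
          ≤ C' * B1.aSeq a P.L (j + 1) * P.mesh (j + 1) ^ κ
            + (D₁ * P.mesh (j + 1) ^ 2 *
                (B1.aSeq a P.L (j + 1) * (P.mesh (j + 1))⁻¹ ^ 2 * (|C.e| * (δA * (P.d * ((P.L : ℝ) ^ (j + 1) * Sbox))) * P.mesh 0 * (P.d * ((P.L : ℝ) ^ (j + 1) - 1))) * (c₁ * tPhi * pℓ)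
                  + |C.e| * (δA * (P.d * ((P.L : ℝ) ^ (j + 1) * Sbox))) * (P.d * ((B1.aSeq a P.L (j + 1) * (P.mesh (j + 1))⁻¹ ^ 2 * (c₁ * tPhi * pℓ) * D₄ * P.mesh (j + 1)
                        + |C.e| * (δA * (P.d * ((P.L : ℝ) ^ (j + 1) * Sbox))) * (B1.aSeq a P.L (j + 1) * D₃ * (c₁ * tPhi * pℓ))) + |C.e| * (δA * (P.d * ((P.L : ℝ) ^ (j + 1) * Sbox))) * (B1.aSeq a P.L (j + 1) * D₃ * (c₁ * tPhi * pℓ))))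
                  + B1.aSeq a P.L (j + 1) * (P.mesh (j + 1))⁻¹ ^ 2 *
                      ((2 * (|C.e| * (δA * (P.d * ((P.L : ℝ) ^ (j + 1) * Sbox))) * P.mesh 0 * (P.d * ((P.L : ℝ) ^ (j + 1) - 1)))
                        + (|C.e| * (δA * (P.d * ((P.L : ℝ) ^ (j + 1) * Sbox))) * P.mesh 0 * (P.d * ((P.L : ℝ) ^ (j + 1) - 1))) ^ 2) * (B1.aSeq a P.L (j + 1) * D₃ * (c₁ * tPhi * pℓ))))
              + D₂ * P.mesh (j + 1) * (|C.e| * (δA * (P.d * ((P.L : ℝ) ^ (j + 1) * Sbox))) * (B1.aSeq a P.L (j + 1) * D₃ * (c₁ * tPhi * pℓ))))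
            + B1.aSeq a P.L (j + 1) * C₃ *
                (4 * M * ((P.mesh (j + 1) * (c₁ * pℓ) + P.mesh (j + 1) * |C.e| * (δA * (P.d * ((P.L : ℝ) ^ (j + 1) * Sbox))) * (c₁ * tPhi * pℓ)) * P.d)
                  + Real.exp (-(1 / (4 * M) * ((R₁ : ℝ) + 1))) * (c₁ * tPhi * pℓ))
            + msq * P.mesh (j + 1) ^ 2 / (B1.aSeq a P.L (j + 1) + msq * P.mesh (j + 1) ^ 2) * (c₁ * tPhi * pℓ)
            + |C.e| * P.mesh 0 * (P.d * ((P.L : ℝ) ^ (j + 1) - 1)) * (δA * (P.d * ((P.L : ℝ) ^ (j + 1) * Sbox))) * (c₁ * tPhi * pℓ) := by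
  obtain ⟨δ, CV, CF, hδ, hCV, hCF, K₀min, h⟩ :=
    eq265_higgs_region_pow d L hd hL ha hmsq haV hmu0 N C ε₀ creg β hcreg hβ Q hQ hT mexp hθ₁ hθ₂ κ
  refine ⟨δ, CV, CF, hδ, hCV, hCF, K₀min, fun M hM => ?_⟩
  obtain ⟨e₁, t, he₁, ht, C₁, C₂, C₃, D₁, D₂, D₃, D₄, hC₁, hC₂, hC₃, hD₁, hD₂, hD₃, hD₄, C', hC', h⟩ := h M hM
  refine ⟨e₁, t, he₁, ht, C₁, C₂, C₃, D₁, D₂, D₃, D₄, hC₁, hC₂, hC₃, hD₁, hD₂, hD₃, hD₄, C', hC', ?_⟩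
  intro P S hPd hPL hPM j hjK h3 hε h1 bad rad hrad sq₂ sq₁ Sfin q Sbox hs2 h16 hbox hSbox hsq₂ h2S q₁ R₁ m hR₁m hRm hsq₁
    ζ ρ ρ₁ hρ₁ zeta_abs zeta_supp zeta_one zeta_lip Rn hRn hRn2 n hn hroom C₀ A' c₁ pℓ tA tPhi hc₁ hpℓ htPhi hθm hθR htT δA h60δ
    ht' ec hec hle hsmall x hmargin hcentre φ h255
  -- the tower supplies: `M ∣ M`, `Λ₆′ ⊆ Λ₂′`, `Bᵏ(Λ₂′)` a big-block union of cube size `M`, and the cube condition into `Λ₋₁′`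
  have hdvd : M ∣ P.M := hPM ▸ dvd_refl _
  have h62 : prime (towerRegion bad rad j 6) ⊆ prime (towerRegion bad rad j 2) := prime_towerRegion_six_subset_two bad hrad.le
  have hΩ : IsBigBlockUnion (j + 1) M (underRegion (j + 1) (prime (towerRegion bad rad j 2))) :=
    hPM ▸ isBigBlockUnion_towerRegion_prime bad rad j 2
  have hjK' : j < P.K := hjK
  have hcube : ∀ y ∈ prime (towerRegion bad rad j 2), ∀ y' : HiggsLattice.Site P (j + 1),
      HiggsLattice.Site.tdist y y' ≤ Rn → y' ∈ prime (near (towerRegion bad rad j 0) (rad j)) := by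
    intro y hy y' hyy'
    have hx : blockIter (j + 1) (toFinest y) ∈ prime (towerRegion bad rad j 2) := by rwa [blockIter_toFinest hjK]
    have hd' : (HiggsLattice.Site.tdist (blockIter (j + 1) (toFinest y)) y' : ℝ) ≤ ((Rn : ℝ) - 1) + 1 := by
      rw [blockIter_toFinest hjK]; linarith [show (HiggsLattice.Site.tdist y y' : ℝ) ≤ Rn by exact_mod_cast hyy']
    have hroom' : (P.L : ℝ) * (((Rn : ℝ) - 1) + 2) - 1 ≤ 3 * (n : ℝ) := by linarith
    exact nbhd_towerRegion hjK' hrad.le hn hroom' (toFinest y) y' hx hd'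
  exact h P S hPd hPL hdvd (Nat.succ_le_succ (Nat.zero_le j)) hjK h3 hε h1 _ _ sq₂ sq₁ Sfin q Sbox h62 hs2 h16 hΩ hbox hSbox hsq₂
    h2S q₁ R₁ m hR₁m hRm hsq₁ _ ζ ρ ρ₁ hρ₁ zeta_abs zeta_supp zeta_one zeta_lip Rn hRn hRn2 hcube C₀ A' hc₁ hpℓ htPhi hθm hθR htT
    h60δ ht' hec hle hsmall x hmargin hcentre φ h255

/-- Print's (2.7) radius `r(ℓ) = R(1 + log ℓ⁻¹)^r` is positive for `R > 0` and `0 < ℓ ≤ 1` (then `1 + log ℓ⁻¹ ≥ 1`).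
[cite: Balaban1982Higgs2, (2.7) p.558 «r(ε) = R(1 + log ε⁻¹)^r … r > 1, R > R₀»] -/
theorem rFn_pos {R r ℓ : ℝ} (hR : 0 < R) (hℓ : 0 < ℓ) (hℓ1 : ℓ ≤ 1) : 0 < B2.rFn R r ℓ := by
  unfold B2.rFn
  have hlog : 1 ≤ 1 + Real.log ℓ⁻¹ := by
    have := Real.log_nonneg ((one_le_inv₀ hℓ).mpr hℓ1)
    linarith
  exact mul_pos hR (Real.rpow_pos_of_pos (lt_of_lt_of_le one_pos hlog) r)

/-- **(2.65) FOR PRINT'S OWN REGIONS WITH PRINT'S OWN RADIUS FUNCTION (2.7) AT EVERY STEP, the (2.67) tails as `O((Lᵏε)^κ)`**: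
`eq265_higgs_tower_pow` with the tower's radius function `rad := fun i => B2.rFn Q.R Q.r (P.mesh i)` = print's `r(Lⁱε) =
R(1 + log (Lⁱε)⁻¹)^r` for the SAME printed parameters `Q` (`Q.Printed`: `R > 0`, `r > 1`) as the readings of the `□`-radii —
p.570 «Λ₋₁^{(k)} … distant from the set B(P_v^{(k)}) ∪ … more than r(Lᵏε)», p.558 (2.8) «with distances from the set Λ_iᶜ less or
equal r(ε)»; the binders `(rad : ℕ → ℝ), 0 < rad j →` are REMOVED (positivity from `Q.Printed` and `Lʲε ≤ Lʲ⁺¹ε ≤ 1`), every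
occurrence of `rad` substituted, nothing else changed. [cite: Balaban1982Higgs2, Lemma 2.4 (2.65) p.572]
[cite: Balaban1982Higgs2, (2.7)–(2.8) p.558, (2.55)–(2.56) p.570, (2.43) p.566] -/
theorem eq265_higgs_tower_pow_r (d L : ℕ) (hd : 1 ≤ d) (hL : Odd L ∧ 1 < L) {a : ℝ} (ha : 0 < a) {msq : ℝ} (hmsq : 0 < msq)
    {aV : ℝ} (haV : 0 < aV) {mu0sq : ℝ} (hmu0 : 0 < mu0sq)
    (N : ℕ) (C : ChargeData N) (ε₀ : ℝ) (creg β : ℝ) (hcreg : 0 ≤ creg) (hβ : 0 < β)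
    (Q : B2.Params) (hQ : Q.Printed) {T : ℝ} (hT : 0 ≤ T) (mexp : ℝ) {θ₁ θ₂ : ℝ} (hθ₁ : 0 < θ₁) (hθ₂ : 0 < θ₂) (κ : ℝ) :
    ∃ δ CV CF : ℝ, 0 < δ ∧ 0 < CV ∧ 0 < CF ∧
    ∃ Mmin : ℕ, ∀ M : ℕ, Mmin ≤ M → ∃ e₁ t : ℝ, 0 < e₁ ∧ 0 < t ∧
      ∃ C₁ C₂ C₃ D₁ D₂ D₃ D₄ : ℝ, 0 ≤ C₁ ∧ 0 ≤ C₂ ∧ 0 ≤ C₃ ∧ 0 ≤ D₁ ∧ 0 ≤ D₂ ∧ 0 ≤ D₃ ∧ 0 ≤ D₄ ∧ ∃ C' : ℝ, 0 ≤ C' ∧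
      ∀ (P : HiggsLattice.Params) (_ : Shape P), P.d = d → P.L = L → P.M = M →
      ∀ {j : ℕ}, j + 1 ≤ P.K → (∀ μ, 3 * half P (j + 1) M ≤ P.sitesPerDir 0 μ) → P.mesh (j + 1) ≤ ε₀ → P.mesh (j + 1) ≤ 1 →
      -- PRINT'S OWN REGIONS with print's own radii `r(Lⁱε)`: the (2.7)–(2.8)/(2.43) tower of step `j`, primed to `T^{(k)}`, `k = j + 1`
      ∀ (bad : (l : ℕ) → Set (HiggsLattice.Site P l)),
      ∀ (sq₂ sq₁ : Finset (HiggsLattice.Site P (j + 1))) (S : Fin P.d → Finset ℕ) (q : HiggsLattice.Site P (j + 1)) (Sbox : ℕ),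
        sq₂ ⊆ prime (towerRegion bad (fun i => B2.rFn Q.R Q.r (P.mesh i)) j 2) →
        sq₁ ⊆ prime (towerRegion bad (fun i => B2.rFn Q.R Q.r (P.mesh i)) j 6) →
        underRegion (j + 1) sq₂ = cellBox (j + 1) M S →
        (∀ μ : Fin P.d, P.L ^ (j + 1) * Sbox < P.sitesPerDir 0 μ) →
        (∀ y : HiggsLattice.Site P (j + 1), y ∈ sq₂ ↔ ∀ ν : Fin P.d, (y ν - q ν).val < Sbox) →
        (∀ μ : Fin P.d, 2 * (P.L ^ (j + 1) * Sbox) ≤ P.sitesPerDir 0 μ) →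
      ∀ (q₁ : HiggsLattice.Site P (j + 1)) (R₁ m : ℕ), R₁ ≤ m → 2 * rS P (j + 1) M + 2 * half P (j + 1) M * (P.d + 1) + 1 ≤ P.L ^ (j + 1) * m →
        (∀ y : HiggsLattice.Site P (j + 1), y ∈ sq₁ ↔ ∀ ν : Fin P.d, (y ν - q₁ ν).val < 2 * R₁ + 1) →
      ∀ (ζ : HiggsLattice.Site P 0 → HiggsLattice.Site P (j + 1) → ℝ) (ρ ρ₁ : ℝ), 0 ≤ ρ₁ →
        (∀ x y', |ζ x y'| ≤ 1) →
        (∀ x y', ζ x y' ≠ 0 → (HiggsLattice.Site.tdist (blockIter (j + 1) x) y' : ℝ) ≤ ρ) →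
        (∀ x y', (HiggsLattice.Site.tdist (blockIter (j + 1) x) y' : ℝ) ≤ ρ₁ → ζ x y' = 1) →
        (∀ (x : HiggsLattice.Site P 0) (ν : Fin P.d) (y' : HiggsLattice.Site P (j + 1)), |ζ (x.shift ν) y' - ζ x y'| ≤ ((P.L : ℝ) ^ (j + 1))⁻¹) →
      -- the room condition with print's radius: `L(R_n + 1) − 1 ≤ 3n`, `n < r(Lʲε)`
      ∀ (Rn : ℕ), ρ + 1 ≤ (Rn : ℝ) → (∀ μ : Fin P.d, 2 * (2 * Rn + 1) ≤ P.sitesPerDir (j + 1) μ) →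
      ∀ (n : ℕ), (n : ℝ) < B2.rFn Q.R Q.r (P.mesh j) → (P.L : ℝ) * ((Rn : ℝ) + 1) - 1 ≤ 3 * (n : ℝ) →
      ∀ (C₀ : ChargeData P.d) (A' : HiggsLattice.VecField P (j + 1)) {c₁ pℓ tA tPhi : ℝ}, 0 ≤ c₁ → 0 ≤ pℓ → 0 ≤ tPhi →
        θ₁ * B2.rFn Q.R Q.r (P.mesh (j + 1)) ≤ (m : ℝ) → θ₂ * B2.rFn Q.R Q.r (P.mesh (j + 1)) ≤ (R₁ : ℝ) + 1 →
        c₁ * tPhi * pℓ ≤ T * P.mesh (j + 1) ^ (-mexp) →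
      ∀ {δA : ℝ}, ((P.L : ℝ) ^ (j + 1))⁻¹ * (CV * P.d * (P.mesh (j + 1) * (c₁ * pℓ)) + CF * Real.exp (-(δ * ρ₁)) * (c₁ * tA * pℓ)) ≤ δA →
          (P.L : ℝ) ^ (j + 1) * δA * |C.e| ≤ t →
        ∀ {ec : ℝ}, 0 < ec → ec ≤ e₁ → (P.L : ℝ) ^ (j + 1) * P.mesh (j + 1) * |C.e| * δA ≤ creg * ec ^ β →
      ∀ (x : HiggsLattice.Site P 0),
        (∀ ν : Fin P.d, m ≤ ((blockIter (j + 1) x) ν - q ν).val ∧ ((blockIter (j + 1) x) ν - q ν).val + m < Sbox) →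
        (∀ ν : Fin P.d, ((blockIter (j + 1) x) ν - q₁ ν).val = R₁) →
      ∀ (φ : HiggsLattice.ScalarField P (j + 1) N),
        Restr255 C c₁ pℓ tA tPhi (j + 1)
          (prime (near (towerRegion bad (fun i => B2.rFn Q.R Q.r (P.mesh i)) j 0) (B2.rFn Q.R Q.r (P.mesh j)))) A' φ
          (ofSite (cutMin C₀ mu0sq aV (j + 1) ζ (toSite A'))) →
        ‖bgScalar256 C msq a (j + 1) (prime (towerRegion bad (fun i => B2.rFn Q.R Q.r (P.mesh i)) j 2))
              (prime (towerRegion bad (fun i => B2.rFn Q.R Q.r (P.mesh i)) j 6))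
              (ofSite (cutMin C₀ mu0sq aV (j + 1) ζ (toSite A'))) φ x
            - avgQkAdj C (ofSite (cutMin C₀ mu0sq aV (j + 1) ζ (toSite A'))) (j + 1) φ x‖
          ≤ C' * B1.aSeq a P.L (j + 1) * P.mesh (j + 1) ^ κ
            + (D₁ * P.mesh (j + 1) ^ 2 *
                (B1.aSeq a P.L (j + 1) * (P.mesh (j + 1))⁻¹ ^ 2 * (|C.e| * (δA * (P.d * ((P.L : ℝ) ^ (j + 1) * Sbox))) * P.mesh 0 * (P.d * ((P.L : ℝ) ^ (j + 1) - 1))) * (c₁ * tPhi * pℓ)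
                  + |C.e| * (δA * (P.d * ((P.L : ℝ) ^ (j + 1) * Sbox))) * (P.d * ((B1.aSeq a P.L (j + 1) * (P.mesh (j + 1))⁻¹ ^ 2 * (c₁ * tPhi * pℓ) * D₄ * P.mesh (j + 1)
                        + |C.e| * (δA * (P.d * ((P.L : ℝ) ^ (j + 1) * Sbox))) * (B1.aSeq a P.L (j + 1) * D₃ * (c₁ * tPhi * pℓ))) + |C.e| * (δA * (P.d * ((P.L : ℝ) ^ (j + 1) * Sbox))) * (B1.aSeq a P.L (j + 1) * D₃ * (c₁ * tPhi * pℓ))))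
                  + B1.aSeq a P.L (j + 1) * (P.mesh (j + 1))⁻¹ ^ 2 *
                      ((2 * (|C.e| * (δA * (P.d * ((P.L : ℝ) ^ (j + 1) * Sbox))) * P.mesh 0 * (P.d * ((P.L : ℝ) ^ (j + 1) - 1)))
                        + (|C.e| * (δA * (P.d * ((P.L : ℝ) ^ (j + 1) * Sbox))) * P.mesh 0 * (P.d * ((P.L : ℝ) ^ (j + 1) - 1))) ^ 2) * (B1.aSeq a P.L (j + 1) * D₃ * (c₁ * tPhi * pℓ))))
              + D₂ * P.mesh (j + 1) * (|C.e| * (δA * (P.d * ((P.L : ℝ) ^ (j + 1) * Sbox))) * (B1.aSeq a P.L (j + 1) * D₃ * (c₁ * tPhi * pℓ))))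
            + B1.aSeq a P.L (j + 1) * C₃ *
                (4 * M * ((P.mesh (j + 1) * (c₁ * pℓ) + P.mesh (j + 1) * |C.e| * (δA * (P.d * ((P.L : ℝ) ^ (j + 1) * Sbox))) * (c₁ * tPhi * pℓ)) * P.d)
                  + Real.exp (-(1 / (4 * M) * ((R₁ : ℝ) + 1))) * (c₁ * tPhi * pℓ))
            + msq * P.mesh (j + 1) ^ 2 / (B1.aSeq a P.L (j + 1) + msq * P.mesh (j + 1) ^ 2) * (c₁ * tPhi * pℓ)
            + |C.e| * P.mesh 0 * (P.d * ((P.L : ℝ) ^ (j + 1) - 1)) * (δA * (P.d * ((P.L : ℝ) ^ (j + 1) * Sbox))) * (c₁ * tPhi * pℓ) := by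
  obtain ⟨δ, CV, CF, hδ, hCV, hCF, Mmin, h⟩ :=
    eq265_higgs_tower_pow d L hd hL ha hmsq haV hmu0 N C ε₀ creg β hcreg hβ Q hQ hT mexp hθ₁ hθ₂ κ
  refine ⟨δ, CV, CF, hδ, hCV, hCF, Mmin, fun M hM => ?_⟩
  obtain ⟨e₁, t, he₁, ht, C₁, C₂, C₃, D₁, D₂, D₃, D₄, hC₁, hC₂, hC₃, hD₁, hD₂, hD₃, hD₄, C', hC', h⟩ := h M hM
  refine ⟨e₁, t, he₁, ht, C₁, C₂, C₃, D₁, D₂, D₃, D₄, hC₁, hC₂, hC₃, hD₁, hD₂, hD₃, hD₄, C', hC', ?_⟩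
  intro P S hPd hPL hPM j hjK h3 hε h1 bad
  -- print's radius at step `j` is positive: `R > 0` (`Q.Printed`) and `Lʲε ≤ Lʲ⁺¹ε ≤ 1`
  have hrad : 0 < (fun i => B2.rFn Q.R Q.r (P.mesh i)) j :=
    rFn_pos hQ.2.2.2.2.2.2.2 (P.mesh_pos j) ((B3Ineq210RegularTorus.mesh_mono P (Nat.le_succ j)).trans h1)
  exact h P S hPd hPL hPM hjK h3 hε h1 bad (fun i => B2.rFn Q.R Q.r (P.mesh i)) hrad

end TowerPow

end Literature.MathematicalPhysics.QuantumFieldTheory.Balaban1983to89.B2Eq265HiggsTowerPow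

end
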